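import Summits.AtomisticToContinuum.Crystallization.Theses.PricedLinkCensus
import Summits.AtomisticToContinuum.Crystallization.Theorems.PricedLinkCensusStackingHingeOfSupportCore
import Summits.AtomisticToContinuum.Crystallization.Theorems.PalmUnimodularRigidityLayeredLawsSelectHcpDefs
import Summits.AtomisticToContinuum.Crystallization.Theorems.ReggeStarCoercivityDefectFreeCrystallizesExactSelectionLaw
import Literature.Geometry.DiscreteGeometry.KissingPatterns
import Literature.Probability.Process.PointStationaryLaw

/-!
# Line `virial-shape-ratio` — crux `PricedLinkCensus.StackingHinge` (item stmt-AtomisticToContinuum-14993)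
# CHECKED ALTERNATIVE SKELETON — crux-strategist gen 1 (planner-cstrat-stmt-AtomisticToContinuum-14993-s1-0), 2026-08-17

Crux (by name, concluded by `StackingHinge_of` below): `StackingHinge = SoftLayerPropagation → ChargeFreeWindows →
GroundStatesChargePeriodic`.  This line re-proves lead c4's SUPPORT CORE (`supportCore_of_stubs`, the exact signature of v32's
`stub_slpLawSupportCore`, so c4's landed one-line closer `PricedHcpWindowsSupportCore.stub_gscpOfSupportCore` p145881 applies) from a
SCALE-FREE cut of the analytic core.  It is an ALTERNATIVE to the live line `Sketch` (lead c5, v34, RESHAPE 12); it shares V4/V5 with it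
verbatim and consumes the same landed X3.

THE LEVER (virial / optimal-dilation identity, law level).  Write `S₆(P) = E_P[∫ ‖y‖⁻⁶ dμ]`, `S₁₂(P) = E_P[∫ ‖y‖⁻¹² dμ]` (root power
sums of the Palm law) and `Φ(P) = S₆²/S₁₂` — invariant under dilating the whole law.  Since `V_LJ(r) = r⁻¹²/12 − r⁻⁶/6`,
`E_P[h] = S₁₂/24 − S₆/12`, and for the dilated law `P_t`: `E_{P_t}[h] = t⁻¹²S₁₂/24 − t⁻⁶S₆/12 ≥ −S₆²/(24 S₁₂)` with equality at
`t⁶ = S₁₂/S₆`.  Hence the EXACT identity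
    `E_P[h] − hcpE(a₀,h₀) = (S₁₂ − S₆)²/(24 S₁₂) + (Φ* − Φ(P))/24`,   `Φ* := −24·hcpE(a₀,h₀) = max_{h/a} C₆(h/a)²/C₁₂(h/a)`
(the tree already locates `(a₀,h₀)` this way: `stub_relaxedReferenceExclusion`, shape function `S₃²/S₆`).  So the energy hypothesis
`E_P[h] ≤ hcpE` of the support core is EQUIVALENT to `Φ(P) ≥ Φ* + (S₁₂−S₆)²/S₁₂`: the only way to reach the hcp level is to MAXIMISE the
scale-free shape ratio AND sit at zero pressure.  The class of this crux (everywhere SLP-good + bond-shell-good + locally Barlow,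
point-stationary, hard core) is itself dilation-invariant — free scale is exactly what distinguishes it from 9226/13603 — so the core of
the crux is naturally a statement about `Φ` alone:
  V2 `stub_shapeRatioFloor` (XL, THE CORE): ROBUST SCALE-FREE SHAPE FLOOR `S₆² + κ θ² P(Bad_θ) S₁₂ ≤ Φ*·S₁₂` over the class, where
  `Bad_θ` = "the root star (the twelve bonded neighbours) is NOT two-way `θt`-matched to `t·A(F)` for any rotation `A`, DILATION `t > 0`
  and two-type reference star `F ∈ {refStar a₀ h₀, a₀ • fccKissingPattern}`" — word-blind (9226-s2 §S⁺5) AND scale-blind.  No energy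
  hypothesis, no absolute window, no gross-scale regime: SCALE enters the glue only through the identity (zero pressure comes out as
  `S₆ = S₁₂ = Φ*`), honouring `Negative/ScaleSelection` (p99020) in one line of algebra instead of inside the XL stub.
  V1 `stub_rootPowerSums` (M): `E = S₁₂/24 − S₆/12`, `S₁₂ > 0` (hard-core summability / Bochner bookkeeping).
  V3 `stub_similarStarNormalisation` (M/L, deterministic): stars similarity-matched at every tolerance at every point of an everywhere-good
  set ⇒ ONE dilation `t` and, for `t⁻¹ • S`, the ABSOLUTE exact two-type stars of line `Sketch` (punctured `5/4`-balls) — compactness of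
  `O(3) × [t-range] × {F₁,F₂}`, scale constancy along bonds (both strut lengths of the relaxed star lie within `1 %`, enclosure
  `tube_minimiserEnclosure`), emptiness of the annulus up to `5/4` from the neighbours' exact stars + SLP layering + `13/20` separation.
  V4 `stub_idealStarRigidity` (M) / V5 `stub_relaxedStarRigidity` (L): VERBATIM line `Sketch` v34 (lead c5) — one proof closes both lines.
  V6 `stub_dilationPinning` (M/L, law level, exact geometry): a law a.s. carried by DILATED exact stackings `t·A(barlowStacking a₀ h s)`,
  `h ∈ {h₀, a₀√(2/3)}`, with `E_P[h] ≤ hcpE a₀ h₀` is a.s. carried by undilated ones (`t = 1`): site column `stub_siteColumnLJ` p141765 on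
  the 3063 box `a ∈ [47/50, 1]`, `tube_hcpE_unique_minimiser`, word-uniform gross bounds outside the box (margins ≥ 1.8e-2 ≫ 1e-4).
  X3 `stub_exactSelectionLaw`: LANDED (13603 lead c9) — referenced, no sorry.
Glue (`supportCore_of_stubs`, sorry-free): V1 + V2 + `E ≤ hcpE` ⇒ `Φ*S₁₂ ≤ S₆²` (AM–GM, `phiStar_mul_le_sq`) ⇒ `P(Bad_{1/(n+1)}) = 0 ∀ n`
⇒ a.s. root star matched at every tolerance ⇒ (Aldous–Lyons `ae_forall_map_sub_of_ae`) at every point ⇒ V3 ⇒ V4/V5 (`em` on the ratio)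
⇒ a.s. dilated exact stacking ⇒ V6 ⇒ X3 ⇒ a.s. exact rotated `hcpStacking a₀ h₀` ⇒ the support event has probability one (tail verbatim
from c4/c5).  `lean check`: rc 0, sorries = the six `stub_*`, `StackingHinge_of` proves the route item by name.

Numbers (this session, `calc/shape_ratio.py`, pure lattice sums, tail-corrected): `Φ(fcc) = 17.220389`, `Φ(hcp ideal) = 17.222129`,
`Φ* = Φ(hcp, h/a = 0.816382) = 17.2221300` (⇒ `−Φ*/24 = −0.71758875`, tree `hcpE ∈ [−0.7175896, −0.7175890]` ✓; `a* = (S₁₂/S₆)^{1/6} =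
0.971274`, tree `a₀ = 0.97129 ± 1e-4` ✓); per-word deficits at each word's OWN optimal ratio: fcc `1.741e-3`, dhcp `8.72e-4`, 9R `5.81e-4`,
6H `1.161e-3` = `1.741e-3 ×` (fraction of cubic layers) — the letter price in Φ-currency (`÷24` = `7.25e-5` per c-layer in energy ✓ 9226
Disproof §23).  Sitewise the ratio is NOT maximised by hcp (dilating one's own shell by `δ` raises `s₆²/s₁₂` by `+1.9 δ` at first order;
neighbours compensate): the floor is law-level, stationarity is load-bearing — as for every sibling core.

Disproof used: §2 SCALE load-bearing — honoured in the glue (zero pressure `S₆ = S₁₂` pins the law's scale; V6 pins each sample's);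
§3 WORD load-bearing — honoured by X3 (landed) after word-blind V2; no stub is an instance of `Negative/ScaleSelection` or
`Negative/Recurrence` (V2's class is not rescaling-closed per sample: the Mecke identity and everywhere-goodness are per-law, and the
conclusion is dilation-covariant); near-miss W (Sturmian) is excluded by X3's energy level, not by geometry.
HOW A LEAD ADOPTS IT: keep v34; add V1, V2, V3, V6 and `supportCore_of_stubs` next to `slpLawSupportCore_of_stubs` — both compositions
coexist and the crux closes modulo {V2 (+V1,V3,V6)} OR {`stub_slpLawExactStars`}, with V4/V5 common; workers: V1, V6 first (bookkeeping
over landed energetics), V3 next (shares the completion-uniqueness facts of V4/V5).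
-/

noncomputable section

namespace Summit.AtomisticToContinuum.Crystallization.Cruxes.StackingHinge.VirialShapeRatio

open Literature.MathematicalPhysics.StatisticalMechanics
open Literature.Geometry.DiscreteGeometry
open Literature.Probability.Process
open Summit.AtomisticToContinuum.Crystallization.Theses.PricedLinkCensus
open Summit.AtomisticToContinuum.Crystallization.Theses
open Summit.AtomisticToContinuum.Crystallization.Theorems
open Summit.AtomisticToContinuum.Crystallization.Theorems.PalmUnimodularRigidity
  (ae_forall_map_sub_of_ae count_restrict_floorNorm_preimage_lt_top)
open Summit.AtomisticToContinuum.Crystallization.Theorems.PricedHcpWindowsAllPointsOfRoot (eq_of_count_restrict_eq)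
open Filter Topology MeasureTheory Set

/-! ## Registered stubs of this line (signatures fully inlined and qualified; `sorry` lives only here) -/

/-- **V1 `stub_rootPowerSums`** (M; Bochner bookkeeping under the hard core).  For a probability law `P` on counting measures of `ℝ³`, a.s.
rooted and `δ`-separated and a.s. everywhere bond-shell-good (twelve bonded neighbours), the mean root energy splits into the two ROOT
POWER SUMS, `E_P[½∫V_LJ(‖y‖)dμ] = S₁₂(P)/24 − S₆(P)/12` with `S_k(P) = ∫∫ ‖y‖⁻ᵏ dμ dP` (the root term is `0` by `0⁻¹ = 0`), and
`S₁₂(P) > 0`.  Proof: on a `δ`-separated `S ∋ 0`, `Σ_{y ∈ S} ‖y‖⁻⁶ ≤ C(δ)` (shell counting, cf. landed `stub_hardCoreTail` p138109: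
`Σ_{‖y‖ ≥ L} ‖y‖⁻⁶ ≤ 3456 δ⁻³ L⁻³`), so both inner integrals are honest `tsum`s, bounded, and measurable in `μ` (lintegral of a fixed
measurable function); linearity of the two Bochner integrals; positivity from one bonded neighbour at distance `≤ 1.01·nn`.  Why it might
fail: only if a measurability convention bites (then restate with `∫⁻`); the identity itself is `V_LJ = r⁻¹²/12 − r⁻⁶/6`. [folklore] -/
theorem stub_rootPowerSums : ∀ δ : ℝ, 0 < δ → ∀ P : MeasureTheory.Measure (MeasureTheory.Measure (EuclideanSpace ℝ (Fin 3))), MeasureTheory.IsProbabilityMeasure P → (∀ᵐ μ ∂P, (∃ S : Set (EuclideanSpace ℝ (Fin 3)), (0 : EuclideanSpace ℝ (Fin 3)) ∈ S ∧ (∀ x ∈ S, ∀ y ∈ S, x ≠ y → δ ≤ dist x y) ∧ μ = (MeasureTheory.Measure.count : MeasureTheory.Measure (EuclideanSpace ℝ (Fin 3))).restrict S)) → (∀ᵐ μ ∂P, ∃ S : Set (EuclideanSpace ℝ (Fin 3)), μ = (MeasureTheory.Measure.count : MeasureTheory.Measure (EuclideanSpace ℝ (Fin 3))).restrict S ∧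 ∀ x ∈ S, (∀ t r : ℝ, Metric.infDist x (S \ {x}) / 6 < t → r < 3 * Metric.infDist x (S \ {x}) → ∃ s : ℤ → ℤ, Literature.MathematicalPhysics.StatisticalMechanics.IsHaggSeq s ∧ ∃ g : EuclideanSpace ℝ (Fin 3) ≃ᵃⁱ[ℝ] EuclideanSpace ℝ (Fin 3), (∀ y ∈ S, dist x y ≤ r → ∃ z ∈ Literature.MathematicalPhysics.StatisticalMechanics.barlowStacking (Metric.infDist x (S \ {x})) (Metric.infDist x (S \ {x}) * Real.sqrt (2 / 3)) s, dist y (g z) ≤ t) ∧ (∀ z ∈ Literature.MathematicalPhysics.StatisticalMechanics.barlowStacking (Metric.infDist x (S \ {x})) (Metric.infDist x (S \ {x}) * Real.sqrt (2 / 3)) s, dist x (g z) ≤ r → ∃ y ∈ S, dist y (g z) ≤ t)) ∧ ((∀ y ∈ S, y ≠ x → dist x y < 107 / 100 * Metric.infDist x (S \ {x}) → dist x y ≤ 101 / 100 * Metric.infDist x (S \ {x})) ∧ ∃ T : Finset (EuclideanSpace ℝ (Fin 3)), (↑T : Set (EuclideanSpace ℝ (Fin 3))) ⊆ {y : EuclideanSpace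 ℝ (Fin 3) | y ∈ S ∧ y ≠ x ∧ dist x y ≤ 101 / 100 * Metric.infDist x (S \ {x})} ∧ T.card = 12)) → (∫ μ, (∫ y, Literature.MathematicalPhysics.StatisticalMechanics.lennardJones ‖y‖ ∂μ) / 2 ∂P) = (∫ μ, (∫ y, (‖y‖⁻¹) ^ 12 ∂μ) ∂P) / 24 - (∫ μ, (∫ y, (‖y‖⁻¹) ^ 6 ∂μ) ∂P) / 12 ∧ 0 < (∫ μ, (∫ y, (‖y‖⁻¹) ^ 12 ∂μ) ∂P) := by
  sorry

/-- **V2 `stub_shapeRatioFloor`** (XL; THE CORE of this line; OPEN).  ROBUST SCALE-FREE SHAPE FLOOR.  For the relaxed reference `(a₀,h₀)`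
(box + global `hcpE`-minimality as inputs) and every hard core `δ > 0` there is `κ > 0` such that for every probability law `P` on counting
measures of `ℝ³` that is a.s. rooted `δ`-hard-core, point-stationary (Mecke identity), a.s. everywhere SLP-good ∧ bond-shell-good and a.s.
(hypotheses VERBATIM those of `stub_slpLawSupportCore` minus the two energy clauses and minus the local-Barlow clause, which is a landed CONSEQUENCE: `PricedHcpWindowsSupportCore.lawLocalStructure_holds`), and every `θ ∈ (0,1]`:
    `S₆(P)² + κ·θ²·P(Bad_θ)·S₁₂(P) ≤ (−24·hcpE a₀ h₀)·S₁₂(P)`,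
`S_k(P) = ∫∫ ‖y‖⁻ᵏ dμ dP`, `Bad_θ = {count|S : ¬∃ A ∈ O(3), t > 0, F ∈ {refStar a₀ h₀, a₀•fccKissingPattern} with the root star
{y ∈ S ∖ 0 : ‖y‖ ≤ 1.01·nn₀} two-way (θt)-matched to t·A(F)}` (outer measure; no measurability needed).  Equivalently (divide by `S₁₂`,
dilation-invariant): `Φ(P) := S₆²/S₁₂ ≤ Φ* − κθ²P(Bad_θ)`, `Φ* = −24·hcpE(a₀,h₀) = max over c/a of C₆²/C₁₂` — relaxed-hcp SHAPE is the
coercive maximiser of the scale-free virial ratio among everywhere-good stationary laws, with a two-type (word-blind), similarity-invariant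
(scale-blind) star defect.  Why this form: (i) the class of THIS crux fixes no scale and `Φ` needs none — no absolute window `[0.9,1.1]`,
no gross-scale regime, no transition zone: every site of the class is within the (1 %, exact-link, nn/6) shape tube at its OWN scale, so a
second-order expansion is uniformly available; (ii) by `E − hcpE = (S₁₂−S₆)²/(24S₁₂) + (Φ*−Φ)/24` it is exactly what `E ≤ hcpE` needs, and
it is dilation-uniform (= the family of linear floors `E_{P_t}[h] ≥ hcpE + κ'E[defect] ∀ t`), hence mixture-friendly and usable by
contradiction/compactness (normalise `S₁₂ = 1`; a Φ-maximiser over the open class is an equilibrium, so force balance / zero stress are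
recovered at the extremal law without assuming minimality); (iii) word-blind: fcc and every exact two-type-starred law has `P(Bad) = 0` and
is priced by `Φ < Φ*` alone, so `κ` is set by elastic/jitterbug distortions (`κ = O(1)` expected), not by the stacking-fault scale `7e-5`;
(iv) kit-testable: ONE law in the class with `S₆² > (Φ* − κθ²P(Bad_θ))S₁₂` refutes it — evaluate `Φ` on relaxed faulted stackings
(deficit `1.74e-3·f_c`, this session), sheared / modulated hcp (`½·C_el ε²`), jitterbug-distorted periodic cells.  What a proof needs
(unchanged physics, new currency): word-uniform second-order coercivity of the layered LJ family in frame-free law-level form (the XL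
residue shared with 9226/13603), with the breathing mode REMOVED from the certificate and the c/a mode kept (box modulus m3′ p132088 in
ratio form = `stub_relaxedReferenceExclusion` + Hessian `≥ 2.689` j019316); null-Lagrangian first-order terms vanish by the Mecke identity
(landed calculus of 9226: `tube_meckeIntegral`, `tube_corrector_mean_zero`); Jensen prices scale VARIANCE across the law for free
(`C₆²·Var_P(nn⁻⁶)` exactly, no smallness); entering the harmonic regime from SLP precision `nn/6` needs the neighbours' constraints
(truss LP of this session: first-shell amplification 5.25 (fcc) / 5.06 (hcp) per unit bar tolerance, radius-independent R = 2,3,4 — i.e.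
1 % bonds pin the first shell to 5.3 %, the second to ≈ 10–12 %).  STRONGER than `stub_slpLawExactStars` by the clause "over ALL
everywhere-good stationary laws, not only periodic-minimising ones" (a law beating relaxed hcp at its optimal dilation without being a
ground-state limit would kill V2 and not necessarily the crux) — the same physical bet (Stillinger 2001; 9226 Disproof §23), cleaner
falsifier.  Why it might fail: an everywhere-good point-stationary law with `Φ(P) > Φ*` — a relaxed polytype gaining more than
`1.74e-3·f_c` in Φ (floats: relaxation `≤ 3e-6` relative), an incommensurate modulation exploiting a failure of word-uniform phonon
coercivity (floats `κ ≈ 0.92`, uncertified), or a soft near-jitterbug stationary distortion inside the 1 % tube. [folklore] -/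
theorem stub_shapeRatioFloor : ∀ a₀ h₀ : ℝ, 189 / 200 ≤ a₀ → a₀ ≤ 199 / 200 → 77 / 100 ≤ h₀ → h₀ ≤ 163 / 200 → (∀ a h : ℝ, 0 < a → 0 < h → Summit.AtomisticToContinuum.Crystallization.Theorems.PalmUnimodularRigidity.LayeredLawsSelectHcp.hcpE a₀ h₀ ≤ Summit.AtomisticToContinuum.Crystallization.Theorems.PalmUnimodularRigidity.LayeredLawsSelectHcp.hcpE a h) → ∀ δ : ℝ, 0 < δ → ∃ κ : ℝ, 0 < κ ∧ ∀ P : MeasureTheory.Measure (MeasureTheory.Measure (EuclideanSpace ℝ (Fin 3))), MeasureTheory.IsProbabilityMeasure P → (∀ᵐ μ ∂P, (∃ S : Set (EuclideanSpace ℝ (Fin 3)), (0 : EuclideanSpace ℝ (Fin 3)) ∈ S ∧ (∀ x ∈ S, ∀ y ∈ S, x ≠ y → δ ≤ dist x y) ∧ μ = (MeasureTheory.Measure.count : MeasureTheory.Measure (EuclideanSpace ℝ (Fin 3))).restrict S)) → (∀ g : MeasureTheory.Measure (EuclideanSpace ℝ (Fin 3)) → EuclideanSpace ℝ (Fin 3)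 → ENNReal, Measurable (Function.uncurry g) → ∫⁻ μ, ∫⁻ y, g μ y ∂μ ∂P = ∫⁻ μ, ∫⁻ y, g (MeasureTheory.Measure.map (fun z => z - y) μ) (-y) ∂μ ∂P) → (∀ᵐ μ ∂P, ∃ S : Set (EuclideanSpace ℝ (Fin 3)), μ = (MeasureTheory.Measure.count : MeasureTheory.Measure (EuclideanSpace ℝ (Fin 3))).restrict S ∧ ∀ x ∈ S, (∀ t r : ℝ, Metric.infDist x (S \ {x}) / 6 < t → r < 3 * Metric.infDist x (S \ {x}) → ∃ s : ℤ → ℤ, Literature.MathematicalPhysics.StatisticalMechanics.IsHaggSeq s ∧ ∃ g : EuclideanSpace ℝ (Fin 3) ≃ᵃⁱ[ℝ] EuclideanSpace ℝ (Fin 3), (∀ y ∈ S, dist x y ≤ r → ∃ z ∈ Literature.MathematicalPhysics.StatisticalMechanics.barlowStacking (Metric.infDist x (S \ {x})) (Metric.infDist x (S \ {x}) * Real.sqrt (2 / 3)) s, dist y (g z) ≤ t) ∧ (∀ z ∈ Literature.MathematicalPhysics.StatisticalMechanics.barlowStacking (Metric.infDist x (S \ {x})) (Metric.infDist x (S \ {x})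 * Real.sqrt (2 / 3)) s, dist x (g z) ≤ r → ∃ y ∈ S, dist y (g z) ≤ t)) ∧ ((∀ y ∈ S, y ≠ x → dist x y < 107 / 100 * Metric.infDist x (S \ {x}) → dist x y ≤ 101 / 100 * Metric.infDist x (S \ {x})) ∧ ∃ T : Finset (EuclideanSpace ℝ (Fin 3)), (↑T : Set (EuclideanSpace ℝ (Fin 3))) ⊆ {y : EuclideanSpace ℝ (Fin 3) | y ∈ S ∧ y ≠ x ∧ dist x y ≤ 101 / 100 * Metric.infDist x (S \ {x})} ∧ T.card = 12)) → ∀ θ : ℝ, 0 < θ → θ ≤ 1 → (∫ μ, (∫ y, (‖y‖⁻¹) ^ 6 ∂μ) ∂P) ^ 2 + κ * θ ^ 2 * (P {μ | ∃ S : Set (EuclideanSpace ℝ (Fin 3)), μ = (MeasureTheory.Measure.count : MeasureTheory.Measure (EuclideanSpace ℝ (Fin 3))).restrict S ∧ ¬ (∃ A : EuclideanSpace ℝ (Fin 3) ≃ₗᵢ[ℝ] EuclideanSpace ℝ (Fin 3), ∃ t : ℝ, 0 < t ∧ ∃ F : Set (EuclideanSpace ℝ (Fin 3)), (F = (↑(Summit.AtomisticToContinuum.Crystallization.Theorems.PalmUnimodularRigidity.LayeredLawsSelectHcp.refStar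 a₀ h₀) : Set (EuclideanSpace ℝ (Fin 3))) ∨ F = ((fun p : EuclideanSpace ℝ (Fin 3) => a₀ • p) '' (↑Literature.Geometry.DiscreteGeometry.fccKissingPattern : Set (EuclideanSpace ℝ (Fin 3))))) ∧ (∀ y ∈ {y : EuclideanSpace ℝ (Fin 3) | y ∈ S ∧ y ≠ 0 ∧ ‖y‖ ≤ 101 / 100 * Metric.infDist (0 : EuclideanSpace ℝ (Fin 3)) (S \ {0})}, ∃ v ∈ F, dist y (t • A v) ≤ θ * t) ∧ (∀ v ∈ F, ∃ y ∈ {y : EuclideanSpace ℝ (Fin 3) | y ∈ S ∧ y ≠ 0 ∧ ‖y‖ ≤ 101 / 100 * Metric.infDist (0 : EuclideanSpace ℝ (Fin 3)) (S \ {0})}, dist y (t • A v) ≤ θ * t))}).toReal * (∫ μ, (∫ y, (‖y‖⁻¹) ^ 12 ∂μ) ∂P) ≤ (-24 * Summit.AtomisticToContinuum.Crystallization.Theorems.PalmUnimodularRigidity.LayeredLawsSelectHcp.hcpE a₀ h₀) * (∫ μ, (∫ y, (‖y‖⁻¹) ^ 12 ∂μ) ∂P) := by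
  sorry

/-- **V3 `stub_similarStarNormalisation`** (M/L; deterministic geometry, no potential, no measure).  SIMILAR EXACT STARS ⇒ ONE DILATION AND
ABSOLUTE EXACT STARS.  Let `(a₀,h₀)` be the relaxed reference (box + global minimality: the enclosure `tube_minimiserEnclosure` then gives
`|√(a₀²/3+h₀²)/a₀ − 1| < 1e-3`), `S ∋ 0` `δ`-separated with every point SLP-good ∧ bond-shell-good (the per-point body of the support core's
hypothesis, verbatim; the local Barlow structure — twelve symmetric bonds, `13/20` separation, exact links — follows by the landed
`PricedHcpWindowsLocalBarlowStructure.stub_localBarlowStructure` p137456), and suppose that at EVERY `x ∈ S` and every tolerance `1/(n+1)` the root star of `S − x`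
(its twelve bonded neighbours, radius `1.01·nn_x`) is two-way `(t/(n+1))`-matched to `t·A(F)` for some rotation `A`, dilation `t > 0` and
`F ∈ {refStar a₀ h₀, a₀ • fccKissingPattern}`.  Then there is ONE `t > 0` with `S = t • S'`, `0 ∈ S'`, and every `x ∈ S'` has the
ABSOLUTE exact two-type star of line `Sketch`: the punctured `5/4`-ball of `S' − x` EQUALS `A_x '' refStar a₀ h₀` or
`A_x '' (a₀ • fccKissingPattern)`.  Route: (1) compactness — `t_n ∈ [nn/0.98, 1.04·nn]`, `O(3)` compact, two shapes — gives an exact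
similar star at each point; (2) SCALE CONSTANCY along bonds: an exact star exhibits its strut lengths (`t a₀` and `t√(a₀²/3+h₀²)`, both
within `1.01·nn` by the enclosure), a neighbour's star contains the shared bond and — by the SLP layering at precision `nn/6 < 0.29·nn`
(inter-pattern matching distance) — sees it with the same in-layer/polar type, so `t_y = t_x`; connectedness of the bond graph of an
everywhere-good set (covering radius `a/√2 < 1.07a` excludes a second component); (3) ANNULUS: a point of `S − x` with norm in
`(1.01·nn, 1.287·nn]` would be SLP-matched to a second-shell pattern point (`‖p‖ ∈ {1, √2}·nn` below `1.46·nn`, word-independent), whose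
exact position is pinned by the exact star of a common first-shell neighbour (completion uniqueness: 12/12/48 extending isometries, one
completion — 13603 gen 2 `calc/star_rigidity_check.py`), at `√2·nn ± 1e-4`; `13/20`-separation makes the two coincide — contradiction.
Shares all its rigidity facts with V4/V5.  Why it might fail: only through the SLP-layering step in (2) if a `nn/6`-matching could flip the
hexagon of an exact anticuboctahedron onto a cuboctahedral pattern shell (it cannot: `0.29 > 1/6 + 1/6·…` needs the margin computed). [folklore] -/
theorem stub_similarStarNormalisation : ∀ a₀ h₀ : ℝ, 189 / 200 ≤ a₀ → a₀ ≤ 199 / 200 → 77 / 100 ≤ h₀ → h₀ ≤ 163 / 200 → (∀ a h : ℝ, 0 < a → 0 < h → Summit.AtomisticToContinuum.Crystallization.Theorems.PalmUnimodularRigidity.LayeredLawsSelectHcp.hcpE a₀ h₀ ≤ Summit.AtomisticToContinuum.Crystallization.Theorems.PalmUnimodularRigidity.LayeredLawsSelectHcp.hcpE a h) → ∀ δ : ℝ, 0 < δ → ∀ S : Set (EuclideanSpace ℝ (Fin 3)), (0 : EuclideanSpace ℝ (Fin 3)) ∈ S → (∀ x ∈ S, ∀ y ∈ S, x ≠ y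 → δ ≤ dist x y) → (∀ x ∈ S, (∀ t r : ℝ, Metric.infDist x (S \ {x}) / 6 < t → r < 3 * Metric.infDist x (S \ {x}) → ∃ s : ℤ → ℤ, Literature.MathematicalPhysics.StatisticalMechanics.IsHaggSeq s ∧ ∃ g : EuclideanSpace ℝ (Fin 3) ≃ᵃⁱ[ℝ] EuclideanSpace ℝ (Fin 3), (∀ y ∈ S, dist x y ≤ r → ∃ z ∈ Literature.MathematicalPhysics.StatisticalMechanics.barlowStacking (Metric.infDist x (S \ {x})) (Metric.infDist x (S \ {x}) * Real.sqrt (2 / 3)) s, dist y (g z) ≤ t) ∧ (∀ z ∈ Literature.MathematicalPhysics.StatisticalMechanics.barlowStacking (Metric.infDist x (S \ {x})) (Metric.infDist x (S \ {x}) * Real.sqrt (2 / 3)) s, dist x (g z) ≤ r → ∃ y ∈ S, dist y (g z) ≤ t)) ∧ ((∀ y ∈ S, y ≠ x → dist x y < 107 / 100 * Metric.infDist x (S \ {x}) → dist x y ≤ 101 / 100 * Metric.infDist x (S \ {x})) ∧ ∃ T : Finset (EuclideanSpace ℝ (Fin 3)), (↑T : Set (EuclideanSpace ℝ (Fin 3)))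 ⊆ {y : EuclideanSpace ℝ (Fin 3) | y ∈ S ∧ y ≠ x ∧ dist x y ≤ 101 / 100 * Metric.infDist x (S \ {x})} ∧ T.card = 12)) → (∀ x ∈ S, ∀ n : ℕ, ∃ A : EuclideanSpace ℝ (Fin 3) ≃ₗᵢ[ℝ] EuclideanSpace ℝ (Fin 3), ∃ t : ℝ, 0 < t ∧ ∃ F : Set (EuclideanSpace ℝ (Fin 3)), (F = (↑(Summit.AtomisticToContinuum.Crystallization.Theorems.PalmUnimodularRigidity.LayeredLawsSelectHcp.refStar a₀ h₀) : Set (EuclideanSpace ℝ (Fin 3))) ∨ F = ((fun p : EuclideanSpace ℝ (Fin 3) => a₀ • p) '' (↑Literature.Geometry.DiscreteGeometry.fccKissingPattern : Set (EuclideanSpace ℝ (Fin 3))))) ∧ (∀ y ∈ {y : EuclideanSpace ℝ (Fin 3) | y ∈ ((fun p : EuclideanSpace ℝ (Fin 3) => p - x) '' S) ∧ y ≠ 0 ∧ ‖y‖ ≤ 101 / 100 * Metric.infDist (0 : EuclideanSpace ℝ (Fin 3)) (((fun p : EuclideanSpace ℝ (Fin 3) => p - x) '' S) \ {0})}, ∃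 v ∈ F, dist y (t • A v) ≤ 1 / ((n : ℝ) + 1) * t) ∧ (∀ v ∈ F, ∃ y ∈ {y : EuclideanSpace ℝ (Fin 3) | y ∈ ((fun p : EuclideanSpace ℝ (Fin 3) => p - x) '' S) ∧ y ≠ 0 ∧ ‖y‖ ≤ 101 / 100 * Metric.infDist (0 : EuclideanSpace ℝ (Fin 3)) (((fun p : EuclideanSpace ℝ (Fin 3) => p - x) '' S) \ {0})}, dist y (t • A v) ≤ 1 / ((n : ℝ) + 1) * t)) → ∃ t : ℝ, 0 < t ∧ ∃ S' : Set (EuclideanSpace ℝ (Fin 3)), S = (fun z : EuclideanSpace ℝ (Fin 3) => t • z) '' S' ∧ (0 : EuclideanSpace ℝ (Fin 3)) ∈ S' ∧ (∀ x ∈ S', ∃ A : EuclideanSpace ℝ (Fin 3) ≃ₗᵢ[ℝ] EuclideanSpace ℝ (Fin 3), ({y : EuclideanSpace ℝ (Fin 3) | y ∈ ((fun p : EuclideanSpace ℝ (Fin 3) => p - x) '' S') ∧ y ≠ 0 ∧ ‖y‖ ≤ 5 / 4} = A '' (↑(Summit.AtomisticToContinuum.Crystallization.Theorems.PalmUnimodularRigidity.LayeredLawsSelectHcp.refStar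 a₀ h₀) : Set (EuclideanSpace ℝ (Fin 3))) ∨ {y : EuclideanSpace ℝ (Fin 3) | y ∈ ((fun p : EuclideanSpace ℝ (Fin 3) => p - x) '' S') ∧ y ≠ 0 ∧ ‖y‖ ≤ 5 / 4} = A '' ((fun p : EuclideanSpace ℝ (Fin 3) => a₀ • p) '' (↑Literature.Geometry.DiscreteGeometry.fccKissingPattern : Set (EuclideanSpace ℝ (Fin 3)))))) := by
  sorry

/-- **V4 `stub_idealStarRigidity`** — VERBATIM `stub_idealStarRigidity` of line `Sketch` v34 (lead c5; M; pure geometry): SHARED BY NAME AND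
SIGNATURE, one proof closes it on both lines.  Ideal ratio `h₀ = a₀√(2/3)`: everywhere-exact two-type stars (punctured `5/4`-balls) ⇒
exact rotated Barlow stacking, via the PROVED Hales layer theorem `HalesDSP_layerPackings_holds` (c5's docstring). [folklore] -/
theorem stub_idealStarRigidity : ∀ a₀ h₀ : ℝ, 189 / 200 ≤ a₀ → a₀ ≤ 199 / 200 → 77 / 100 ≤ h₀ → h₀ ≤ 163 / 200 → h₀ = a₀ * Real.sqrt (2 / 3) → ∀ S : Set (EuclideanSpace ℝ (Fin 3)), (0 : EuclideanSpace ℝ (Fin 3)) ∈ S → (∀ x ∈ S, ∃ A : EuclideanSpace ℝ (Fin 3) ≃ₗᵢ[ℝ] EuclideanSpace ℝ (Fin 3), ({y : EuclideanSpace ℝ (Fin 3) | y ∈ ((fun p : EuclideanSpace ℝ (Fin 3) => p - x) '' S) ∧ y ≠ 0 ∧ ‖y‖ ≤ 5 / 4} = A '' (↑(Summit.AtomisticToContinuum.Crystallization.Theorems.PalmUnimodularRigidity.LayeredLawsSelectHcp.refStar a₀ h₀) : Set (EuclideanSpace ℝ (Fin 3))) ∨ {y : EuclideanSpace ℝ (Fin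 3) | y ∈ ((fun p : EuclideanSpace ℝ (Fin 3) => p - x) '' S) ∧ y ≠ 0 ∧ ‖y‖ ≤ 5 / 4} = A '' ((fun p : EuclideanSpace ℝ (Fin 3) => a₀ • p) '' (↑Literature.Geometry.DiscreteGeometry.fccKissingPattern : Set (EuclideanSpace ℝ (Fin 3)))))) → ∃ A : EuclideanSpace ℝ (Fin 3) ≃ₗᵢ[ℝ] EuclideanSpace ℝ (Fin 3), ∃ h : ℝ, (h = h₀ ∨ h = a₀ * Real.sqrt (2 / 3)) ∧ ∃ s' : ℤ → ℤ, Literature.MathematicalPhysics.StatisticalMechanics.IsHaggSeq s' ∧ S = A '' Literature.MathematicalPhysics.StatisticalMechanics.barlowStacking a₀ h s' := by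
  sorry

/-- **V5 `stub_relaxedStarRigidity`** — VERBATIM `stub_relaxedStarRigidity` of line `Sketch` v34 (lead c5; L; pure geometry): SHARED BY NAME AND
SIGNATURE.  Non-ideal ratio: types do not mix along bonds, the layer normal propagates, all-hcp ⇒ exact rotated `hcpStacking a₀ h₀`
(landed `rigid_of_netFacts` + net facts p136584/p136291/p136329), all-fcc ⇒ Hales (c5's docstring). [folklore] -/
theorem stub_relaxedStarRigidity : ∀ a₀ h₀ : ℝ, 189 / 200 ≤ a₀ → a₀ ≤ 199 / 200 → 77 / 100 ≤ h₀ → h₀ ≤ 163 / 200 → h₀ ≠ a₀ * Real.sqrt (2 / 3) → ∀ S : Set (EuclideanSpace ℝ (Fin 3)), (0 : EuclideanSpace ℝ (Fin 3)) ∈ S → (∀ x ∈ S, ∃ A : EuclideanSpace ℝ (Fin 3) ≃ₗᵢ[ℝ] EuclideanSpace ℝ (Fin 3), ({y : EuclideanSpace ℝ (Fin 3) | y ∈ ((fun p : EuclideanSpace ℝ (Fin 3) => p - x) '' S) ∧ y ≠ 0 ∧ ‖y‖ ≤ 5 / 4} = A '' (↑(Summit.AtomisticToContinuum.Crystallization.Theorems.PalmUnimodularRigidity.LayeredLawsSelectHcp.refStar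 a₀ h₀) : Set (EuclideanSpace ℝ (Fin 3))) ∨ {y : EuclideanSpace ℝ (Fin 3) | y ∈ ((fun p : EuclideanSpace ℝ (Fin 3) => p - x) '' S) ∧ y ≠ 0 ∧ ‖y‖ ≤ 5 / 4} = A '' ((fun p : EuclideanSpace ℝ (Fin 3) => a₀ • p) '' (↑Literature.Geometry.DiscreteGeometry.fccKissingPattern : Set (EuclideanSpace ℝ (Fin 3)))))) → ∃ A : EuclideanSpace ℝ (Fin 3) ≃ₗᵢ[ℝ] EuclideanSpace ℝ (Fin 3), ∃ h : ℝ, (h = h₀ ∨ h = a₀ * Real.sqrt (2 / 3)) ∧ ∃ s' : ℤ → ℤ, Literature.MathematicalPhysics.StatisticalMechanics.IsHaggSeq s' ∧ S = A '' Literature.MathematicalPhysics.StatisticalMechanics.barlowStacking a₀ h s' := by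
  sorry

/-- **V6 `stub_dilationPinning`** (M/L; law level, EXACT geometry, energetics landed on the box).  DILATION PINNING.  For the relaxed
reference `(a₀,h₀)` (box + global `hcpE`-minimality), a probability law on rooted `δ`-hard-core configurations, point-stationary, a.s. the
counting measure of a DILATED rotated exact stacking `t • A(barlowStacking a₀ h s)` (`t > 0`, `h ∈ {h₀, a₀√(2/3)}`, `s` Hägg — all
sample-dependent) with mean root energy `≤ hcpE a₀ h₀`, is a.s. the counting measure of an UNDILATED one (`t = 1`; conclusion VERBATIM the
hypothesis of the landed X3).  Route: the root is the site `0` (`0 ∈ S` a.s.), `t • barlowStacking a₀ h s = barlowStacking (ta₀) (th) s`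
(`barlowStacking_eq_smul`), root energy `= barlowSiteEnergy lennardJones (ta₀) (th) s 0` (`tsum_points_eq_two_mul_barlowSiteEnergy`,
landed); for `ta₀ ∈ [47/50, 1]` (ratio `h/a₀ ∈ {0.8164, 0.8165} ⊂ [0.78, 0.85]`) the landed column `SiteColumnLJ.stub_siteColumnLJ`
(p141765) gives `≥ hcpE (ta₀) (th) ≥ hcpE a₀ h₀`, equality only at `(ta₀,th) = (a₀,h₀)` (`tube_hcpE_unique_minimiser` p116871), i.e.
`t = 1`; for `ta₀ ∉ [47/50, 1]` a WORD-UNIFORM gross bound `barlowSiteEnergy ≥ hcpE a₀ h₀ + 1e-2` (hcp dilation curve: `+3.4e-2` at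
`a = 0.94`, `+1.86e-2` at `a = 1.00`, `→ 0⁻ > hcpE` dilute, `→ +∞` compressed; word dependence `≤ Σ_{k≥2}|J_k| ≲ 1e-3`,
`BarlowCouplingDecay`); the integrand is `≥ hcpE` pointwise and its mean is `≤ hcpE`, so a.s. equality (integrable, else the Bochner mean
`0 > hcpE` contradicts the hypothesis; `hcpE a₀ h₀ < 0` from the enclosure sums).  All on import side B (no `MuGSC` module needed).  Why
it might fail: the word-uniform gross bound outside the 3063 box is not yet a landed lemma (margins are 100× the word spread). [folklore] -/
theorem stub_dilationPinning : ∀ a₀ h₀ : ℝ, 189 / 200 ≤ a₀ → a₀ ≤ 199 / 200 → 77 / 100 ≤ h₀ → h₀ ≤ 163 / 200 → (∀ a h : ℝ, 0 < a → 0 < h → Summit.AtomisticToContinuum.Crystallization.Theorems.PalmUnimodularRigidity.LayeredLawsSelectHcp.hcpE a₀ h₀ ≤ Summit.AtomisticToContinuum.Crystallization.Theorems.PalmUnimodularRigidity.LayeredLawsSelectHcp.hcpE a h) → ∀ δ : ℝ, 0 < δ → ∀ P : MeasureTheory.Measure (MeasureTheory.Measure (EuclideanSpace ℝ (Fin 3))),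 MeasureTheory.IsProbabilityMeasure P → (∀ᵐ μ ∂P, (∃ S : Set (EuclideanSpace ℝ (Fin 3)), (0 : EuclideanSpace ℝ (Fin 3)) ∈ S ∧ (∀ x ∈ S, ∀ y ∈ S, x ≠ y → δ ≤ dist x y) ∧ μ = (MeasureTheory.Measure.count : MeasureTheory.Measure (EuclideanSpace ℝ (Fin 3))).restrict S)) → (∀ g : MeasureTheory.Measure (EuclideanSpace ℝ (Fin 3)) → EuclideanSpace ℝ (Fin 3) → ENNReal, Measurable (Function.uncurry g) → ∫⁻ μ, ∫⁻ y, g μ y ∂μ ∂P = ∫⁻ μ, ∫⁻ y, g (MeasureTheory.Measure.map (fun z => z - y) μ) (-y) ∂μ ∂P) → (∀ᵐ μ ∂P, ∃ t : ℝ, 0 < t ∧ ∃ A : EuclideanSpace ℝ (Fin 3) ≃ₗᵢ[ℝ] EuclideanSpace ℝ (Fin 3), ∃ h : ℝ, (h = h₀ ∨ h = a₀ * Real.sqrt (2 / 3)) ∧ ∃ s : ℤ → ℤ, Literature.MathematicalPhysics.StatisticalMechanics.IsHaggSeq s ∧ μ = (MeasureTheory.Measure.count : MeasureTheory.Measure (EuclideanSpace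 ℝ (Fin 3))).restrict ((fun z : EuclideanSpace ℝ (Fin 3) => t • z) '' (A '' Literature.MathematicalPhysics.StatisticalMechanics.barlowStacking a₀ h s))) → (∫ μ, (∫ y, Literature.MathematicalPhysics.StatisticalMechanics.lennardJones ‖y‖ ∂μ) / 2 ∂P) ≤ Summit.AtomisticToContinuum.Crystallization.Theorems.PalmUnimodularRigidity.LayeredLawsSelectHcp.hcpE a₀ h₀ → (∀ᵐ μ ∂P, ∃ A : EuclideanSpace ℝ (Fin 3) ≃ₗᵢ[ℝ] EuclideanSpace ℝ (Fin 3), ∃ h : ℝ, (h = h₀ ∨ h = a₀ * Real.sqrt (2 / 3)) ∧ ∃ s : ℤ → ℤ, Literature.MathematicalPhysics.StatisticalMechanics.IsHaggSeq s ∧ μ = (MeasureTheory.Measure.count : MeasureTheory.Measure (EuclideanSpace ℝ (Fin 3))).restrict (A '' Literature.MathematicalPhysics.StatisticalMechanics.barlowStacking a₀ h s)) := by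
  sorry

/-! ## Landed input (no sorry): X3, selection at exact geometry -/

/-- **X3 `stub_exactSelectionLaw`** — LANDED (13603 lead c9, `PalmGoodLaw.ExactSelectionLaw.stub_exactSelectionLaw`, 2026-08-17);
VERBATIM the shared statement of cruxes 13603 / 9226 / 14993 (v34 of line `Sketch`). [folklore] -/
theorem exactSelectionLaw : ∀ a₀ h₀ : ℝ, 189 / 200 ≤ a₀ → a₀ ≤ 199 / 200 → 77 / 100 ≤ h₀ → h₀ ≤ 163 / 200 → (∀ a h : ℝ, 0 < a → 0 < h → Summit.AtomisticToContinuum.Crystallization.Theorems.PalmUnimodularRigidity.LayeredLawsSelectHcp.hcpE a₀ h₀ ≤ Summit.AtomisticToContinuum.Crystallization.Theorems.PalmUnimodularRigidity.LayeredLawsSelectHcp.hcpE a h) → ∀ δ : ℝ, 0 < δ → ∀ P : MeasureTheory.Measure (MeasureTheory.Measure (EuclideanSpace ℝ (Fin 3))), MeasureTheory.IsProbabilityMeasure P → (∀ᵐ μ ∂P, Literature.Probability.Process.IsRootedHardCore δ μ) → Literature.Probability.Process.IsPointStationaryLaw P → (∫ μ, (∫ y, Literature.MathematicalPhysics.StatisticalMechanics.lennardJones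 ‖y‖ ∂μ) / 2 ∂P) ≤ Summit.AtomisticToContinuum.Crystallization.Theorems.PalmUnimodularRigidity.LayeredLawsSelectHcp.hcpE a₀ h₀ → (∀ᵐ μ ∂P, ∃ A : EuclideanSpace ℝ (Fin 3) ≃ₗᵢ[ℝ] EuclideanSpace ℝ (Fin 3), ∃ h : ℝ, (h = h₀ ∨ h = a₀ * Real.sqrt (2 / 3)) ∧ ∃ s : ℤ → ℤ, Literature.MathematicalPhysics.StatisticalMechanics.IsHaggSeq s ∧ μ = (MeasureTheory.Measure.count : MeasureTheory.Measure (EuclideanSpace ℝ (Fin 3))).restrict (A '' Literature.MathematicalPhysics.StatisticalMechanics.barlowStacking a₀ h s)) → ∀ᵐ μ ∂P, ∃ A : EuclideanSpace ℝ (Fin 3) ≃ₗᵢ[ℝ] EuclideanSpace ℝ (Fin 3), μ = (MeasureTheory.Measure.count : MeasureTheory.Measure (EuclideanSpace ℝ (Fin 3))).restrict (A '' Literature.MathematicalPhysics.StatisticalMechanics.hcpStacking a₀ h₀) :=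
  PalmGoodLaw.ExactSelectionLaw.stub_exactSelectionLaw

/-! ## Glue (no sorry below this line) -/

/-- **Exact-star rigidity, both ratios** (from V4/V5 by `em`; verbatim line `Sketch` v34). [folklore] -/
theorem exactStarRigidity : ∀ a₀ h₀ : ℝ, 189 / 200 ≤ a₀ → a₀ ≤ 199 / 200 → 77 / 100 ≤ h₀ → h₀ ≤ 163 / 200 → ∀ S : Set (EuclideanSpace ℝ (Fin 3)), (0 : EuclideanSpace ℝ (Fin 3)) ∈ S → (∀ x ∈ S, ∃ A : EuclideanSpace ℝ (Fin 3) ≃ₗᵢ[ℝ] EuclideanSpace ℝ (Fin 3), ({y : EuclideanSpace ℝ (Fin 3) | y ∈ ((fun p : EuclideanSpace ℝ (Fin 3) => p - x) '' S) ∧ y ≠ 0 ∧ ‖y‖ ≤ 5 / 4} = A '' (↑(Summit.AtomisticToContinuum.Crystallization.Theorems.PalmUnimodularRigidity.LayeredLawsSelectHcp.refStar a₀ h₀) : Set (EuclideanSpace ℝ (Fin 3))) ∨ {y : EuclideanSpace ℝ (Fin 3) | y ∈ ((fun p : EuclideanSpace ℝ (Fin 3) => p - x) '' S) ∧ y ≠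 0 ∧ ‖y‖ ≤ 5 / 4} = A '' ((fun p : EuclideanSpace ℝ (Fin 3) => a₀ • p) '' (↑Literature.Geometry.DiscreteGeometry.fccKissingPattern : Set (EuclideanSpace ℝ (Fin 3)))))) → ∃ A : EuclideanSpace ℝ (Fin 3) ≃ₗᵢ[ℝ] EuclideanSpace ℝ (Fin 3), ∃ h : ℝ, (h = h₀ ∨ h = a₀ * Real.sqrt (2 / 3)) ∧ ∃ s' : ℤ → ℤ, Literature.MathematicalPhysics.StatisticalMechanics.IsHaggSeq s' ∧ S = A '' Literature.MathematicalPhysics.StatisticalMechanics.barlowStacking a₀ h s' := by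
  intro a₀ h₀ hb1 hb2 hb3 hb4 S h0 hS
  rcases em (h₀ = a₀ * Real.sqrt (2 / 3)) with hid | hnid
  · exact stub_idealStarRigidity a₀ h₀ hb1 hb2 hb3 hb4 hid S h0 hS
  · exact stub_relaxedStarRigidity a₀ h₀ hb1 hb2 hb3 hb4 hnid S h0 hS

/-- **The virial algebra of the glue.**  From the energy identity `E = S₁₂/24 − S₆/12`, the bound `E ≤ hcpE` and `S₁₂ > 0`:
`(−24·hcpE)·S₁₂ ≤ S₆²` (AM–GM on `2 S₆ ≥ S₁₂ + Φ*`).  [folklore] -/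
theorem phiStar_mul_le_sq {E S6 S12 L : ℝ} (hE : E = S12 / 24 - S6 / 12) (hle : E ≤ L) (hS12 : 0 < S12) :
    (-24 * L) * S12 ≤ S6 ^ 2 := by
  have h2 : S12 + (-24 * L) ≤ 2 * S6 := by linarith
  rcases le_or_gt (-24 * L) 0 with hneg | hpos
  · nlinarith [sq_nonneg S6]
  · have hS6 : 0 ≤ S6 := by linarith
    nlinarith [sq_nonneg (S12 - (-24 * L)), h2, hS6, hpos]

/-- **c4's support core is a THEOREM from the stubs of this line.**  V1 + V2 + `E ≤ hcpE` make every similarity-bad root-star event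
`P`-null (virial algebra `phiStar_mul_le_sq`); Aldous–Lyons carries the matched-at-every-tolerance root star to every point; V3
normalises the dilation and delivers absolute exact two-type stars; V4/V5 (shared with line `Sketch`) give an exact dilated Barlow
stacking; V6 pins the dilation; the LANDED X3 selects hcp; an a.s. exact rotated net charges the support event at every `(R, θ)`. [folklore] -/
theorem supportCore_of_stubs : ∀ a₀ h₀ : ℝ, 189 / 200 ≤ a₀ → a₀ ≤ 199 / 200 → 77 / 100 ≤ h₀ → h₀ ≤ 163 / 200 → (∀ a h : ℝ, 0 < a → 0 < h → Summit.AtomisticToContinuum.Crystallization.Theorems.PalmUnimodularRigidity.LayeredLawsSelectHcp.hcpE a₀ h₀ ≤ Summit.AtomisticToContinuum.Crystallization.Theorems.PalmUnimodularRigidity.LayeredLawsSelectHcp.hcpE a h) → ∀ δ : ℝ, 0 < δ → ∀ P : MeasureTheory.Measure (MeasureTheory.Measure (EuclideanSpace ℝ (Fin 3))), MeasureTheory.IsProbabilityMeasure P → (∀ᵐ μ ∂P, (∃ S : Set (EuclideanSpace ℝ (Fin 3)), (0 : EuclideanSpace ℝ (Fin 3)) ∈ S ∧ (∀ x ∈ S,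 ∀ y ∈ S, x ≠ y → δ ≤ dist x y) ∧ μ = (MeasureTheory.Measure.count : MeasureTheory.Measure (EuclideanSpace ℝ (Fin 3))).restrict S)) → (∀ g : MeasureTheory.Measure (EuclideanSpace ℝ (Fin 3)) → EuclideanSpace ℝ (Fin 3) → ENNReal, Measurable (Function.uncurry g) → ∫⁻ μ, ∫⁻ y, g μ y ∂μ ∂P = ∫⁻ μ, ∫⁻ y, g (MeasureTheory.Measure.map (fun z => z - y) μ) (-y) ∂μ ∂P) → (∀ᵐ μ ∂P, ∃ S : Set (EuclideanSpace ℝ (Fin 3)), μ = (MeasureTheory.Measure.count : MeasureTheory.Measure (EuclideanSpace ℝ (Fin 3))).restrict S ∧ ∀ x ∈ S, (∀ t r : ℝ, Metric.infDist x (S \ {x}) / 6 < t → r < 3 * Metric.infDist x (S \ {x}) → ∃ s : ℤ → ℤ, Literature.MathematicalPhysics.StatisticalMechanics.IsHaggSeq s ∧ ∃ g : EuclideanSpace ℝ (Fin 3) ≃ᵃⁱ[ℝ] EuclideanSpace ℝ (Fin 3), (∀ y ∈ S, dist x y ≤ r → ∃ z ∈ Literature.MathematicalPhysics.StatisticalMechanics.barlowStacking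 (Metric.infDist x (S \ {x})) (Metric.infDist x (S \ {x}) * Real.sqrt (2 / 3)) s, dist y (g z) ≤ t) ∧ (∀ z ∈ Literature.MathematicalPhysics.StatisticalMechanics.barlowStacking (Metric.infDist x (S \ {x})) (Metric.infDist x (S \ {x}) * Real.sqrt (2 / 3)) s, dist x (g z) ≤ r → ∃ y ∈ S, dist y (g z) ≤ t)) ∧ ((∀ y ∈ S, y ≠ x → dist x y < 107 / 100 * Metric.infDist x (S \ {x}) → dist x y ≤ 101 / 100 * Metric.infDist x (S \ {x})) ∧ ∃ T : Finset (EuclideanSpace ℝ (Fin 3)), (↑T : Set (EuclideanSpace ℝ (Fin 3))) ⊆ {y : EuclideanSpace ℝ (Fin 3) | y ∈ S ∧ y ≠ x ∧ dist x y ≤ 101 / 100 * Metric.infDist x (S \ {x})} ∧ T.card = 12)) → (∀ᵐ μ ∂P, ∃ S : Set (EuclideanSpace ℝ (Fin 3)), μ = (MeasureTheory.Measure.count : MeasureTheory.Measure (EuclideanSpace ℝ (Fin 3))).restrict S ∧ ∀ x ∈ S, ((∀ y ∈ S, dist x y ≤ 2 * Metric.infDist x (S \ {x}) → 13 / 20 *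 Metric.infDist x (S \ {x}) ≤ Metric.infDist y (S \ {y})) ∧ (∀ y ∈ S, y ≠ x → dist x y ≤ 101 / 100 * Metric.infDist x (S \ {x}) → dist x y ≤ 101 / 100 * Metric.infDist y (S \ {y})) ∧ ({y : EuclideanSpace ℝ (Fin 3) | y ∈ S ∧ y ≠ x ∧ dist x y ≤ 101 / 100 * Metric.infDist x (S \ {x})}.ncard = 12) ∧ (∀ t r : ℝ, Metric.infDist x (S \ {x}) / 6 < t → t ≤ 7 / 40 * Metric.infDist x (S \ {x}) → 29 / 10 * Metric.infDist x (S \ {x}) ≤ r → ∀ (s : ℤ → ℤ) (g : EuclideanSpace ℝ (Fin 3) ≃ᵃⁱ[ℝ] EuclideanSpace ℝ (Fin 3)), Literature.MathematicalPhysics.StatisticalMechanics.IsHaggSeq s → (∀ y ∈ S, dist x y ≤ r → ∃ z ∈ Literature.MathematicalPhysics.StatisticalMechanics.barlowStacking (Metric.infDist x (S \ {x})) (Metric.infDist x (S \ {x}) * Real.sqrt (2 / 3)) s, dist y (g z) ≤ t) → (∀ z ∈ Literature.MathematicalPhysics.StatisticalMechanics.barlowStacking (Metric.infDist x (S \ {x}))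 (Metric.infDist x (S \ {x}) * Real.sqrt (2 / 3)) s, dist x (g z) ≤ r → ∃ y ∈ S, dist y (g z) ≤ t) → ∀ y ∈ S, ∀ y' ∈ S, y ≠ x → dist x y ≤ 101 / 100 * Metric.infDist x (S \ {x}) → y' ≠ x → dist x y' ≤ 101 / 100 * Metric.infDist x (S \ {x}) → y ≠ y' → ∀ z ∈ Literature.MathematicalPhysics.StatisticalMechanics.barlowStacking (Metric.infDist x (S \ {x})) (Metric.infDist x (S \ {x}) * Real.sqrt (2 / 3)) s, ∀ z' ∈ Literature.MathematicalPhysics.StatisticalMechanics.barlowStacking (Metric.infDist x (S \ {x})) (Metric.infDist x (S \ {x}) * Real.sqrt (2 / 3)) s, dist y (g z) ≤ t → dist y' (g z') ≤ t → (dist y y' ≤ 101 / 100 * Metric.infDist y (S \ {y}) ↔ dist z z' = Metric.infDist x (S \ {x}))))) → (∫ μ, (∫ y, Literature.MathematicalPhysics.StatisticalMechanics.lennardJones ‖y‖ ∂μ) / 2 ∂P) ≤ Summit.AtomisticToContinuum.Crystallization.Theorems.PalmUnimodularRigidity.LayeredLawsSelectHcp.hcpE a₀ h₀ → (∀ Q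 : Literature.MathematicalPhysics.StatisticalMechanics.PeriodicConfiguration 3, (∫ μ, (∫ y, Literature.MathematicalPhysics.StatisticalMechanics.lennardJones ‖y‖ ∂μ) / 2 ∂P) ≤ Q.energyPerParticle Literature.MathematicalPhysics.StatisticalMechanics.lennardJones) → ∀ R θ : ℝ, 0 < R → 0 < θ → P {μ | ∃ S : Set (EuclideanSpace ℝ (Fin 3)), μ = (MeasureTheory.Measure.count : MeasureTheory.Measure (EuclideanSpace ℝ (Fin 3))).restrict S ∧ ∃ A : EuclideanSpace ℝ (Fin 3) ≃ₗᵢ[ℝ] EuclideanSpace ℝ (Fin 3), (∀ y ∈ S, ‖y‖ ≤ R → ∃ z ∈ Literature.MathematicalPhysics.StatisticalMechanics.hcpStacking a₀ h₀, dist y (A z) ≤ θ) ∧ (∀ z ∈ Literature.MathematicalPhysics.StatisticalMechanics.hcpStacking a₀ h₀, ‖z‖ ≤ R → ∃ y ∈ S, dist y (A z) ≤ θ)} ≠ 0 := by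
  intro a₀ h₀ hb1 hb2 hb3 hb4 hglob δ hδ P hP hcore hstat hgood _hLS hle _hper R θ _hR hθ
  obtain ⟨κ, hκ, hfloor⟩ := stub_shapeRatioFloor a₀ h₀ hb1 hb2 hb3 hb4 hglob δ hδ
  obtain ⟨hE, hS12⟩ := stub_rootPowerSums δ hδ P hP hcore hgood
  have hsq := phiStar_mul_le_sq hE hle hS12
  -- every similarity-bad root-star event is `P`-null
  have hnull : ∀ n : ℕ, P {μ | ∃ S : Set (EuclideanSpace ℝ (Fin 3)), μ = (MeasureTheory.Measure.count : MeasureTheory.Measure (EuclideanSpace ℝ (Fin 3))).restrict S ∧ ¬ (∃ A : EuclideanSpace ℝ (Fin 3) ≃ₗᵢ[ℝ] EuclideanSpace ℝ (Fin 3), ∃ t : ℝ, 0 < t ∧ ∃ F : Set (EuclideanSpace ℝ (Fin 3)), (F = (↑(Summit.AtomisticToContinuum.Crystallization.Theorems.PalmUnimodularRigidity.LayeredLawsSelectHcp.refStar a₀ h₀) : Set (EuclideanSpace ℝ (Fin 3))) ∨ F = ((fun p : EuclideanSpace ℝ (Fin 3) => a₀ • p) '' (↑Literature.Geometry.DiscreteGeometry.fccKissingPattern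 : Set (EuclideanSpace ℝ (Fin 3))))) ∧ (∀ y ∈ {y : EuclideanSpace ℝ (Fin 3) | y ∈ S ∧ y ≠ 0 ∧ ‖y‖ ≤ 101 / 100 * Metric.infDist (0 : EuclideanSpace ℝ (Fin 3)) (S \ {0})}, ∃ v ∈ F, dist y (t • A v) ≤ 1 / ((n : ℝ) + 1) * t) ∧ (∀ v ∈ F, ∃ y ∈ {y : EuclideanSpace ℝ (Fin 3) | y ∈ S ∧ y ≠ 0 ∧ ‖y‖ ≤ 101 / 100 * Metric.infDist (0 : EuclideanSpace ℝ (Fin 3)) (S \ {0})}, dist y (t • A v) ≤ 1 / ((n : ℝ) + 1) * t))} = 0 := by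
    intro n
    have hθ' : (0 : ℝ) < 1 / ((n : ℝ) + 1) := by positivity
    have hθ1 : 1 / ((n : ℝ) + 1) ≤ 1 := by
      rw [div_le_one (by positivity)]
      linarith [n.cast_nonneg (α := ℝ)]
    have hfl := hfloor P hP hcore hstat hgood _ hθ' hθ1
    have h3 : (P {μ | ∃ S : Set (EuclideanSpace ℝ (Fin 3)), μ = (MeasureTheory.Measure.count : MeasureTheory.Measure (EuclideanSpace ℝ (Fin 3))).restrict S ∧ ¬ (∃ A : EuclideanSpace ℝ (Fin 3) ≃ₗᵢ[ℝ] EuclideanSpace ℝ (Fin 3), ∃ t : ℝ, 0 < t ∧ ∃ F : Set (EuclideanSpace ℝ (Fin 3)), (F = (↑(Summit.AtomisticToContinuum.Crystallization.Theorems.PalmUnimodularRigidity.LayeredLawsSelectHcp.refStar a₀ h₀) : Set (EuclideanSpace ℝ (Fin 3))) ∨ F = ((fun p : EuclideanSpace ℝ (Fin 3) => a₀ • p) '' (↑Literature.Geometry.DiscreteGeometry.fccKissingPattern : Set (EuclideanSpace ℝ (Fin 3))))) ∧ (∀ y ∈ {y : EuclideanSpace ℝ (Fin 3) | y ∈ S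 ∧ y ≠ 0 ∧ ‖y‖ ≤ 101 / 100 * Metric.infDist (0 : EuclideanSpace ℝ (Fin 3)) (S \ {0})}, ∃ v ∈ F, dist y (t • A v) ≤ 1 / ((n : ℝ) + 1) * t) ∧ (∀ v ∈ F, ∃ y ∈ {y : EuclideanSpace ℝ (Fin 3) | y ∈ S ∧ y ≠ 0 ∧ ‖y‖ ≤ 101 / 100 * Metric.infDist (0 : EuclideanSpace ℝ (Fin 3)) (S \ {0})}, dist y (t • A v) ≤ 1 / ((n : ℝ) + 1) * t))}).toReal ≤ 0 := by
      by_contra hcon'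
      have hcon := not_le.1 hcon'
      have hprod : 0 < κ * (1 / ((n : ℝ) + 1)) ^ 2 * (P {μ | ∃ S : Set (EuclideanSpace ℝ (Fin 3)), μ = (MeasureTheory.Measure.count : MeasureTheory.Measure (EuclideanSpace ℝ (Fin 3))).restrict S ∧ ¬ (∃ A : EuclideanSpace ℝ (Fin 3) ≃ₗᵢ[ℝ] EuclideanSpace ℝ (Fin 3), ∃ t : ℝ, 0 < t ∧ ∃ F : Set (EuclideanSpace ℝ (Fin 3)), (F = (↑(Summit.AtomisticToContinuum.Crystallization.Theorems.PalmUnimodularRigidity.LayeredLawsSelectHcp.refStar a₀ h₀) : Set (EuclideanSpace ℝ (Fin 3))) ∨ F = ((fun p : EuclideanSpace ℝ (Fin 3) => a₀ • p) '' (↑Literature.Geometry.DiscreteGeometry.fccKissingPattern : Set (EuclideanSpace ℝ (Fin 3))))) ∧ (∀ y ∈ {y : EuclideanSpace ℝ (Fin 3) | y ∈ S ∧ y ≠ 0 ∧ ‖y‖ ≤ 101 / 100 * Metric.infDist (0 : EuclideanSpace ℝ (Fin 3)) (S \ {0})}, ∃ v ∈ F, dist y (t • A v) ≤ 1 / ((n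 : ℝ) + 1) * t) ∧ (∀ v ∈ F, ∃ y ∈ {y : EuclideanSpace ℝ (Fin 3) | y ∈ S ∧ y ≠ 0 ∧ ‖y‖ ≤ 101 / 100 * Metric.infDist (0 : EuclideanSpace ℝ (Fin 3)) (S \ {0})}, dist y (t • A v) ≤ 1 / ((n : ℝ) + 1) * t))}).toReal * (∫ μ, (∫ y, (‖y‖⁻¹) ^ 12 ∂μ) ∂P) :=
        mul_pos (mul_pos (mul_pos hκ (by positivity)) hcon) hS12
      linarith
    have h4 : (P {μ | ∃ S : Set (EuclideanSpace ℝ (Fin 3)), μ = (MeasureTheory.Measure.count : MeasureTheory.Measure (EuclideanSpace ℝ (Fin 3))).restrict S ∧ ¬ (∃ A : EuclideanSpace ℝ (Fin 3) ≃ₗᵢ[ℝ] EuclideanSpace ℝ (Fin 3), ∃ t : ℝ, 0 < t ∧ ∃ F : Set (EuclideanSpace ℝ (Fin 3)), (F = (↑(Summit.AtomisticToContinuum.Crystallization.Theorems.PalmUnimodularRigidity.LayeredLawsSelectHcp.refStar a₀ h₀) : Set (EuclideanSpace ℝ (Fin 3))) ∨ F = ((fun p : EuclideanSpace ℝ (Fin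 3) => a₀ • p) '' (↑Literature.Geometry.DiscreteGeometry.fccKissingPattern : Set (EuclideanSpace ℝ (Fin 3))))) ∧ (∀ y ∈ {y : EuclideanSpace ℝ (Fin 3) | y ∈ S ∧ y ≠ 0 ∧ ‖y‖ ≤ 101 / 100 * Metric.infDist (0 : EuclideanSpace ℝ (Fin 3)) (S \ {0})}, ∃ v ∈ F, dist y (t • A v) ≤ 1 / ((n : ℝ) + 1) * t) ∧ (∀ v ∈ F, ∃ y ∈ {y : EuclideanSpace ℝ (Fin 3) | y ∈ S ∧ y ≠ 0 ∧ ‖y‖ ≤ 101 / 100 * Metric.infDist (0 : EuclideanSpace ℝ (Fin 3)) (S \ {0})}, dist y (t • A v) ≤ 1 / ((n : ℝ) + 1) * t))}).toReal = 0 := le_antisymm h3 ENNReal.toReal_nonneg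
    exact (ENNReal.toReal_eq_zero_iff _).1 h4 |>.resolve_right (MeasureTheory.measure_ne_top P _)
  -- a.s. the root star is similarity-matched to a two-type reference star at every tolerance `1/(n+1)`
  have hae : ∀ᵐ μ ∂P, ∀ n : ℕ, μ ∉ {μ | ∃ S : Set (EuclideanSpace ℝ (Fin 3)), μ = (MeasureTheory.Measure.count : MeasureTheory.Measure (EuclideanSpace ℝ (Fin 3))).restrict S ∧ ¬ (∃ A : EuclideanSpace ℝ (Fin 3) ≃ₗᵢ[ℝ] EuclideanSpace ℝ (Fin 3), ∃ t : ℝ, 0 < t ∧ ∃ F : Set (EuclideanSpace ℝ (Fin 3)), (F = (↑(Summit.AtomisticToContinuum.Crystallization.Theorems.PalmUnimodularRigidity.LayeredLawsSelectHcp.refStar a₀ h₀) : Set (EuclideanSpace ℝ (Fin 3))) ∨ F = ((fun p : EuclideanSpace ℝ (Fin 3) => a₀ • p) '' (↑Literature.Geometry.DiscreteGeometry.fccKissingPattern : Set (EuclideanSpace ℝ (Fin 3))))) ∧ (∀ y ∈ {y : EuclideanSpace ℝ (Fin 3) | y ∈ S ∧ y ≠ 0 ∧ ‖y‖ ≤ 101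 / 100 * Metric.infDist (0 : EuclideanSpace ℝ (Fin 3)) (S \ {0})}, ∃ v ∈ F, dist y (t • A v) ≤ 1 / ((n : ℝ) + 1) * t) ∧ (∀ v ∈ F, ∃ y ∈ {y : EuclideanSpace ℝ (Fin 3) | y ∈ S ∧ y ≠ 0 ∧ ‖y‖ ≤ 101 / 100 * Metric.infDist (0 : EuclideanSpace ℝ (Fin 3)) (S \ {0})}, dist y (t • A v) ≤ 1 / ((n : ℝ) + 1) * t))} :=
    MeasureTheory.ae_all_iff.2 fun n => (MeasureTheory.measure_eq_zero_iff_ae_notMem).1 (hnull n)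
  have hroot : ∀ᵐ μ ∂P, ∀ n : ℕ, ∀ S' : Set (EuclideanSpace ℝ (Fin 3)), μ = (MeasureTheory.Measure.count : MeasureTheory.Measure (EuclideanSpace ℝ (Fin 3))).restrict S' → (∃ A : EuclideanSpace ℝ (Fin 3) ≃ₗᵢ[ℝ] EuclideanSpace ℝ (Fin 3), ∃ t : ℝ, 0 < t ∧ ∃ F : Set (EuclideanSpace ℝ (Fin 3)), (F = (↑(Summit.AtomisticToContinuum.Crystallization.Theorems.PalmUnimodularRigidity.LayeredLawsSelectHcp.refStar a₀ h₀) : Set (EuclideanSpace ℝ (Fin 3))) ∨ F = ((fun p : EuclideanSpace ℝ (Fin 3) => a₀ • p) '' (↑Literature.Geometry.DiscreteGeometry.fccKissingPattern : Set (EuclideanSpace ℝ (Fin 3))))) ∧ (∀ y ∈ {y : EuclideanSpace ℝ (Fin 3) | y ∈ S' ∧ y ≠ 0 ∧ ‖y‖ ≤ 101 / 100 * Metric.infDist (0 : EuclideanSpace ℝ (Fin 3)) (S' \ {0})}, ∃ v ∈ F, dist y (t • A v) ≤ 1 / ((n : ℝ) + 1) * t) ∧ (∀ v ∈ F, ∃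 y ∈ {y : EuclideanSpace ℝ (Fin 3) | y ∈ S' ∧ y ≠ 0 ∧ ‖y‖ ≤ 101 / 100 * Metric.infDist (0 : EuclideanSpace ℝ (Fin 3)) (S' \ {0})}, dist y (t • A v) ≤ 1 / ((n : ℝ) + 1) * t)) := by
    filter_upwards [hae] with μ hμ n S' hS'
    by_contra hc
    exact hμ n ⟨S', hS', hc⟩
  -- hard-core configurations are locally finite
  have hlf : ∀ᵐ μ ∂P, ∀ n : ℕ,
      μ ((fun z : EuclideanSpace ℝ (Fin 3) => ⌊‖z‖⌋₊) ⁻¹' {n}) < ⊤ := by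
    filter_upwards [hcore] with μ hμ n
    obtain ⟨S, -, hsep, rfl⟩ := hμ
    exact count_restrict_floorNorm_preimage_lt_top hδ hsep n
  -- everything shows at the root (Aldous–Lyons)
  have hall := ae_forall_map_sub_of_ae hstat hlf hroot
  -- a.s. the configuration is a DILATED exact rotated Barlow stacking with `h ∈ {h₀, a₀√(2/3)}`
  have hstack : (∀ᵐ μ ∂P, ∃ t : ℝ, 0 < t ∧ ∃ A : EuclideanSpace ℝ (Fin 3) ≃ₗᵢ[ℝ] EuclideanSpace ℝ (Fin 3), ∃ h : ℝ, (h = h₀ ∨ h = a₀ * Real.sqrt (2 / 3)) ∧ ∃ s : ℤ → ℤ, Literature.MathematicalPhysics.StatisticalMechanics.IsHaggSeq s ∧ μ = (MeasureTheory.Measure.count : MeasureTheory.Measure (EuclideanSpace ℝ (Fin 3))).restrict ((fun z : EuclideanSpace ℝ (Fin 3) => t • z) '' (A '' Literature.MathematicalPhysics.StatisticalMechanics.barlowStacking a₀ h s))) := by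
    filter_upwards [hcore, hgood, hall] with μ hc hg ha
    obtain ⟨S, h0, hsep, rfl⟩ := hc
    obtain ⟨S₁, hS₁, hg1⟩ := hg
    obtain rfl := eq_of_count_restrict_eq hS₁
    have hmatch : ∀ x ∈ S, ∀ n : ℕ, ∃ A : EuclideanSpace ℝ (Fin 3) ≃ₗᵢ[ℝ] EuclideanSpace ℝ (Fin 3), ∃ t : ℝ, 0 < t ∧ ∃ F : Set (EuclideanSpace ℝ (Fin 3)), (F = (↑(Summit.AtomisticToContinuum.Crystallization.Theorems.PalmUnimodularRigidity.LayeredLawsSelectHcp.refStar a₀ h₀) : Set (EuclideanSpace ℝ (Fin 3))) ∨ F = ((fun p : EuclideanSpace ℝ (Fin 3) => a₀ • p) '' (↑Literature.Geometry.DiscreteGeometry.fccKissingPattern : Set (EuclideanSpace ℝ (Fin 3))))) ∧ (∀ y ∈ {y : EuclideanSpace ℝ (Fin 3) | y ∈ ((fun p : EuclideanSpace ℝ (Fin 3) => p - x) '' S) ∧ y ≠ 0 ∧ ‖y‖ ≤ 101 / 100 * Metric.infDist (0 : EuclideanSpace ℝ (Fin 3)) (((fun p : EuclideanSpace ℝ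 (Fin 3) => p - x) '' S) \ {0})}, ∃ v ∈ F, dist y (t • A v) ≤ 1 / ((n : ℝ) + 1) * t) ∧ (∀ v ∈ F, ∃ y ∈ {y : EuclideanSpace ℝ (Fin 3) | y ∈ ((fun p : EuclideanSpace ℝ (Fin 3) => p - x) '' S) ∧ y ≠ 0 ∧ ‖y‖ ≤ 101 / 100 * Metric.infDist (0 : EuclideanSpace ℝ (Fin 3)) (((fun p : EuclideanSpace ℝ (Fin 3) => p - x) '' S) \ {0})}, dist y (t • A v) ≤ 1 / ((n : ℝ) + 1) * t) := fun x hx n =>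
      ha x ((count_restrict_singleton_ne_zero_iff S x).2 hx) n _ (map_sub_count_restrict S x)
    obtain ⟨t, ht, S', hSS', h0', hstar'⟩ :=
      stub_similarStarNormalisation a₀ h₀ hb1 hb2 hb3 hb4 hglob δ hδ S h0 hsep hg1 hmatch
    obtain ⟨A, h, hh, s', hs', hS'eq⟩ := exactStarRigidity a₀ h₀ hb1 hb2 hb3 hb4 S' h0' hstar'
    exact ⟨t, ht, A, h, hh, s', hs', by rw [hSS', hS'eq]⟩
  -- the dilation is `1` (V6), then selection at exact geometry (X3, landed): a.s. an exact rotated `hcpStacking a₀ h₀`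
  have hpin := stub_dilationPinning a₀ h₀ hb1 hb2 hb3 hb4 hglob δ hδ P hP hcore hstat hstack hle
  have hexact : ∀ᵐ μ ∂P, ∃ A : EuclideanSpace ℝ (Fin 3) ≃ₗᵢ[ℝ] EuclideanSpace ℝ (Fin 3), μ = (MeasureTheory.Measure.count : MeasureTheory.Measure (EuclideanSpace ℝ (Fin 3))).restrict (A '' Literature.MathematicalPhysics.StatisticalMechanics.hcpStacking a₀ h₀) :=
    exactSelectionLaw a₀ h₀ hb1 hb2 hb3 hb4 hglob δ hδ P hP hcore hstat hle hpin
  -- an a.s. event has non-zero measure; an exact rotated net is matched at every `(R, θ)`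
  intro h0
  have hnot : ∀ᵐ μ ∂P, μ ∉ {μ | ∃ S : Set (EuclideanSpace ℝ (Fin 3)), μ = (MeasureTheory.Measure.count : MeasureTheory.Measure (EuclideanSpace ℝ (Fin 3))).restrict S ∧ ∃ A : EuclideanSpace ℝ (Fin 3) ≃ₗᵢ[ℝ] EuclideanSpace ℝ (Fin 3), (∀ y ∈ S, ‖y‖ ≤ R → ∃ z ∈ Literature.MathematicalPhysics.StatisticalMechanics.hcpStacking a₀ h₀, dist y (A z) ≤ θ) ∧ (∀ z ∈ Literature.MathematicalPhysics.StatisticalMechanics.hcpStacking a₀ h₀, ‖z‖ ≤ R → ∃ y ∈ S, dist y (A z) ≤ θ)} :=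
    (MeasureTheory.measure_eq_zero_iff_ae_notMem).1 h0
  haveI : (MeasureTheory.ae P).NeBot := MeasureTheory.ae_neBot.2 (IsProbabilityMeasure.ne_zero P)
  obtain ⟨μ, ⟨A, rfl⟩, hμ⟩ := (hexact.and hnot).exists
  refine hμ ⟨A '' Literature.MathematicalPhysics.StatisticalMechanics.hcpStacking a₀ h₀, rfl, A, ?_, ?_⟩
  · rintro y ⟨z, hz, rfl⟩ _
    exact ⟨z, hz, by simp [hθ.le]⟩
  · intro z hz _
    exact ⟨A z, ⟨z, hz, rfl⟩, by simp [hθ.le]⟩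

/-! ## Composition -/

/-- **The line closes the crux modulo its registered stubs** (support core ⇒ crux: c4's landed `stub_gscpOfSupportCore`, p145881). -/
theorem StackingHinge_of : Summit.AtomisticToContinuum.Crystallization.Theses.PricedLinkCensus.StackingHinge :=
  fun hSLP hCFW => PricedHcpWindowsSupportCore.stub_gscpOfSupportCore supportCore_of_stubs hSLP hCFW

end Summit.AtomisticToContinuum.Crystallization.Cruxes.StackingHinge.VirialShapeRatio

end
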